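import Summits.RiemannHypothesis.RiemannHypothesis.Theorems.PfPersistenceM2EvenSectorMultiplier
import Literature.NumberTheory.LFunctions.WeilMellinBounds
import Mathlib.Analysis.Calculus.BumpFunction.Normed
import HarnessLib

/-!
# Persistence programme, M2 even sector — the cosine factor (pub-rhpf cell, M2 seat, gen 7)

Long-odds MECHANISM SEARCH; **no RH claims**.  RH-free, kernel-checked.

An **elementary probability-average construction** of annihilating test functions (the shape
of the Paley–Wiener closure theorem, complexified); the sequel `…CosineProduct.lean` passes to
the limit.

* `threePoint a q f = (q f(· + 2a) + (1 + q²) f + q f(· - 2a)) / (1 + q)²` is a three-point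
  probability average; on the Mellin side it acts by the multiplier
  `threePointMul a q s = (q e^{-2a(s-1/2)} + 1 + q² + q e^{2a(s-1/2)}) / (1 + q)²`
  (`weilMellin_threePoint`), which is `1` at `s = 1/2`, takes values in `[0, 1]` on the
  critical line (`(1 + q² + 2q cos 2ay)/(1+q)²`, `threePointMul_line`), and — for the choice
  `a = π/(2 Im ρ)`, `q = e^{-2a(Re ρ - 1/2)}` — **vanishes at `ρ`** (`threePointMul_eq_zero`):
  `e^{2a(ρ-1/2)} = -q⁻¹`.
* Iterating over a sequence `ρ₀, ρ₁, …` in the upper half-plane starting from a fixed even real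
  bump `cosSeed` gives even real tests `phiSeq ρ K`, uniformly bounded by `1`, supported in
  `[-suppRadius ρ K, suppRadius ρ K]` with `suppRadius ρ K = 1 + π ∑_{k<K} 1/Im ρₖ`, whose transform is
  `(∏_{k<K} threePointMul …) · cosSeed^` — so it vanishes at `ρ₀, …, ρ_{K-1}` and equals `∫ cosSeed > 0`
  at `1/2`.

All statements here are [folklore] calculus; nothing is cited.
-/

noncomputable section
set_option linter.dupNamespace false

open Complex Filter Set MeasureTheory
open scoped Real Topology ContDiff

namespace Summit.RiemannHypothesis.RiemannHypothesis.Theorems.PfPersistenceM2NegIndex.CosineProduct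

open Literature.NumberTheory.LFunctions

variable {f : ℝ → ℂ} {a q : ℝ}

/-! ## 1. The three-point average and its multiplier -/

/-- The three-point probability average `(q f(t+2a) + (1+q²) f(t) + q f(t-2a)) / (1+q)²`.
[folklore] -/
def threePoint (a q : ℝ) (f : ℝ → ℂ) (t : ℝ) : ℂ :=
  ((q : ℂ) * f (t + 2 * a) + (1 + (q : ℂ) ^ 2) * f t + (q : ℂ) * f (t - 2 * a))
    / (1 + (q : ℂ)) ^ 2

/-- Its Mellin multiplier `(q e^{-2a(s-1/2)} + 1 + q² + q e^{2a(s-1/2)}) / (1+q)²`. [folklore] -/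
def threePointMul (a q : ℝ) (s : ℂ) : ℂ :=
  ((q : ℂ) * cexp (-((s - 1 / 2) * (2 * a : ℝ))) + (1 + (q : ℂ) ^ 2)
    + (q : ℂ) * cexp ((s - 1 / 2) * (2 * a : ℝ))) / (1 + (q : ℂ)) ^ 2

/-- The multiplier on the critical line: `(1 + q² + 2q cos(2ay)) / (1+q)²`. [folklore] -/
def threePointLine (a q y : ℝ) : ℝ :=
  (1 + q ^ 2 + 2 * q * Real.cos (2 * a * y)) / (1 + q) ^ 2

/-- **Multiplier rule**: `(threePoint a q f)^(s) = threePointMul a q s · f̂(s)` for continuous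
compactly supported `f` (translation rule `(f(·+h))^(s) = e^{-(s-1/2)h} f̂(s)` and linearity).
[folklore] -/
theorem weilMellin_threePoint (hf : Continuous f) (hf' : HasCompactSupport f) (a q : ℝ)
    (s : ℂ) : weilMellin (threePoint a q f) s = threePointMul a q s * weilMellin f s := by
  have tr : ∀ h : ℝ, ∫ t : ℝ, f (t + h) * cexp ((s - 1 / 2) * t)
      = cexp (-((s - 1 / 2) * h)) * weilMellin f s := by
    intro h
    unfold weilMellin
    have key := integral_add_right_eq_self (μ := (volume : Measure ℝ))
      (fun t : ℝ ↦ f t * cexp ((s - 1 / 2) * (t - h : ℝ))) h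
    simp only [add_sub_cancel_right] at key
    rw [key, ← integral_const_mul]
    congr 1 with t
    rw [show ((t - h : ℝ) : ℂ) = (t : ℂ) - (h : ℂ) by push_cast; ring, mul_sub, sub_eq_add_neg,
      Complex.exp_add]
    ring
  have hcs : ∀ h : ℝ, HasCompactSupport fun t ↦ f (t + h) := fun h ↦ by
    simpa [Function.comp_def, Homeomorph.coe_addRight] using
      hf'.comp_homeomorph (Homeomorph.addRight h)
  have hpl : ∫ t : ℝ, f (t + 2 * a) * cexp ((s - 1 / 2) * t)
      = cexp (-((s - 1 / 2) * (2 * a : ℝ))) * weilMellin f s := tr (2 * a)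
  have hmi : ∫ t : ℝ, f (t - 2 * a) * cexp ((s - 1 / 2) * t)
      = cexp ((s - 1 / 2) * (2 * a : ℝ)) * weilMellin f s := by
    have := tr (-(2 * a))
    simp only [← sub_eq_add_neg] at this
    rw [this, show -((s - 1 / 2) * ((-(2 * a) : ℝ) : ℂ)) = (s - 1 / 2) * (2 * a : ℝ) by
      push_cast; ring]
  have e1 : Integrable fun t : ℝ ↦ f (t + 2 * a) * cexp ((s - 1 / 2) * t) :=
    integrable_weilIntegrand (by fun_prop) (hcs _) s
  have e2 : Integrable fun t : ℝ ↦ f t * cexp ((s - 1 / 2) * t) := integrable_weilIntegrand hf hf' s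
  have e3 : Integrable fun t : ℝ ↦ f (t - 2 * a) * cexp ((s - 1 / 2) * t) :=
    integrable_weilIntegrand (by fun_prop) (by simpa [sub_eq_add_neg] using hcs (-(2 * a))) s
  have e2' : ∫ t : ℝ, f t * cexp ((s - 1 / 2) * t) = weilMellin f s := rfl
  have i12 : Integrable fun t : ℝ ↦ (q : ℂ) * (f (t + 2 * a) * cexp ((s - 1 / 2) * t))
      + (1 + (q : ℂ) ^ 2) * (f t * cexp ((s - 1 / 2) * t)) := (e1.const_mul _).add (e2.const_mul _)
  calc weilMellin (threePoint a q f) s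
      = ∫ t : ℝ, ((q : ℂ) * (f (t + 2 * a) * cexp ((s - 1 / 2) * t))
          + (1 + (q : ℂ) ^ 2) * (f t * cexp ((s - 1 / 2) * t))
          + (q : ℂ) * (f (t - 2 * a) * cexp ((s - 1 / 2) * t))) / (1 + (q : ℂ)) ^ 2 := by
        unfold weilMellin threePoint
        congr 1 with t
        ring
    _ = ((q : ℂ) * (cexp (-((s - 1 / 2) * (2 * a : ℝ))) * weilMellin f s)
          + (1 + (q : ℂ) ^ 2) * weilMellin f s
          + (q : ℂ) * (cexp ((s - 1 / 2) * (2 * a : ℝ)) * weilMellin f s)) / (1 + (q : ℂ)) ^ 2 := by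
        rw [integral_div, integral_add i12 (e3.const_mul _),
          integral_add (e1.const_mul _) (e2.const_mul _), integral_const_mul, integral_const_mul,
          integral_const_mul, hpl, hmi, e2']
    _ = threePointMul a q s * weilMellin f s := by
        unfold threePointMul
        ring

/-- The multiplier is `1` at the central point (for `q ≠ -1`, in particular `q ≥ 0`).
[folklore] -/
theorem threePointMul_half (hq : 0 ≤ q) (a : ℝ) : threePointMul a q (1 / 2) = 1 := by
  unfold threePointMul
  have h1 : (1 + (q : ℂ)) ≠ 0 := by
    rw [show (1 + (q : ℂ)) = ((1 + q : ℝ) : ℂ) by push_cast; ring]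
    exact_mod_cast (by positivity : (1 + q : ℝ) ≠ 0)
  simp only [sub_self, zero_mul, neg_zero, Complex.exp_zero, mul_one]
  field_simp
  ring

/-- On the critical line the multiplier is the real number `threePointLine a q y`. [folklore] -/
theorem threePointMul_line (a q y : ℝ) :
    threePointMul a q (1 / 2 + y * I) = (threePointLine a q y : ℂ) := by
  unfold threePointMul threePointLine
  have hs : (1 / 2 + (y : ℂ) * I - 1 / 2) = (y : ℂ) * I := by ring
  rw [hs]
  have hc : Complex.cos (2 * (a : ℂ) * (y : ℂ))
      = (cexp ((y : ℂ) * I * (2 * (a : ℂ))) + cexp (-((y : ℂ) * I * (2 * (a : ℂ))))) / 2 := by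
    have h1 : cexp ((y : ℂ) * I * (2 * (a : ℂ))) = cexp ((2 * (a : ℂ) * (y : ℂ)) * I) := by
      congr 1; ring
    have h2 : cexp (-((y : ℂ) * I * (2 * (a : ℂ)))) = cexp (-(2 * (a : ℂ) * (y : ℂ)) * I) := by
      congr 1; ring
    rw [h1, h2, ← Complex.two_cos]
    ring
  push_cast
  rw [hc]
  ring

/-- `0 ≤ threePointLine a q y` for `q ≥ 0` (numerator `≥ (1-q)²`). [folklore] -/
theorem threePointLine_nonneg (hq : 0 ≤ q) (a y : ℝ) : 0 ≤ threePointLine a q y :=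
  div_nonneg (by nlinarith [Real.neg_one_le_cos (2 * a * y), sq_nonneg (1 - q)]) (sq_nonneg _)

/-- `threePointLine a q y ≤ 1` for `q ≥ 0` (numerator `≤ (1+q)²`). [folklore] -/
theorem threePointLine_le_one (hq : 0 ≤ q) (a y : ℝ) : threePointLine a q y ≤ 1 :=
  div_le_one_of_le₀ (by nlinarith [Real.cos_le_one (2 * a * y)]) (sq_nonneg _)

/-! ## 2. The parameters attached to a point of the upper half-plane -/

/-- Half-period `a(ρ) = π / (2 Im ρ)`: then `e^{2a(ρ) i Im ρ} = e^{iπ} = -1`. [folklore] -/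
def halfPeriod (ρ : ℂ) : ℝ := π / (2 * ρ.im)

/-- Weight `q(ρ) = e^{-2a(ρ)(Re ρ - 1/2)} > 0`. [folklore] -/
def cosWeight (ρ : ℂ) : ℝ := Real.exp (-((ρ.re - 1 / 2) * (2 * halfPeriod ρ)))

/-- `q(ρ) > 0`. -/
theorem cosWeight_pos (ρ : ℂ) : 0 < cosWeight ρ := Real.exp_pos _

/-- `a(ρ) > 0` for `Im ρ > 0`. -/
theorem halfPeriod_pos {ρ : ℂ} (hρ : 0 < ρ.im) : 0 < halfPeriod ρ := by
  unfold halfPeriod; positivity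

/-- **The factor kills `ρ`**: `threePointMul a(ρ) q(ρ) ρ = 0` for `Im ρ > 0`, because
`e^{2a(ρ)(ρ - 1/2)} = e^{2a(Re ρ - 1/2)} e^{iπ} = -q(ρ)⁻¹` and `e^{-2a(ρ)(ρ-1/2)} = -q(ρ)`, so the
numerator is `-q² + 1 + q² - 1 = 0`. [folklore] -/
theorem threePointMul_eq_zero {ρ : ℂ} (hρ : 0 < ρ.im) :
    threePointMul (halfPeriod ρ) (cosWeight ρ) ρ = 0 := by
  unfold threePointMul cosWeight
  set a := halfPeriod ρ with ha
  have h2a : ρ.im * (2 * a) = π := by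
    have h2 : (2 * ρ.im) ≠ 0 := by positivity
    calc ρ.im * (2 * a) = 2 * ρ.im * π / (2 * ρ.im) := by rw [ha, halfPeriod]; ring
      _ = π := mul_div_cancel_left₀ π h2
  have hexp : (ρ - 1 / 2) * ((2 * a : ℝ) : ℂ) = (((ρ.re - 1 / 2) * (2 * a) : ℝ) : ℂ) + π * I := by
    conv_lhs => rw [← Complex.re_add_im ρ]
    rw [← h2a]
    push_cast
    ring
  rw [div_eq_zero_iff]
  left
  rw [Complex.exp_neg, hexp, Complex.exp_add_pi_mul_I, Real.exp_neg, Complex.ofReal_inv,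
    Complex.ofReal_exp]
  have hE : cexp ((((ρ.re - 1 / 2) * (2 * a) : ℝ) : ℂ)) ≠ 0 := Complex.exp_ne_zero _
  field_simp
  ring

/-! ## 3. Qualitative properties of the average -/

/-- Evenness is preserved. [folklore] -/
theorem threePoint_even (hf : ∀ t, f (-t) = f t) (a q : ℝ) (t : ℝ) :
    threePoint a q f (-t) = threePoint a q f t := by
  unfold threePoint
  rw [show -t + 2 * a = -(t - 2 * a) by ring, show -t - 2 * a = -(t + 2 * a) by ring, hf, hf, hf]
  ring

/-- Real-valuedness is preserved. [folklore] -/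
theorem threePoint_im (hf : ∀ t, (f t).im = 0) (a q : ℝ) (t : ℝ) :
    (threePoint a q f t).im = 0 := by
  unfold threePoint
  rw [show (1 + (q : ℂ)) ^ 2 = (((1 + q) ^ 2 : ℝ) : ℂ) by push_cast; ring,
    show (1 + (q : ℂ) ^ 2) = ((1 + q ^ 2 : ℝ) : ℂ) by push_cast; ring, Complex.div_ofReal_im]
  simp only [Complex.add_im, Complex.im_ofReal_mul, hf, mul_zero, add_zero, zero_div]

/-- A uniform bound is preserved (`threePoint` is a probability average for `q ≥ 0`).
[folklore] -/
theorem norm_threePoint_le (hq : 0 ≤ q) {B : ℝ} (hB : ∀ t, ‖f t‖ ≤ B) (a t : ℝ) :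
    ‖threePoint a q f t‖ ≤ B := by
  have h1 : (0 : ℝ) < (1 + q) ^ 2 := by positivity
  unfold threePoint
  rw [norm_div, show (1 + (q : ℂ)) ^ 2 = (((1 + q) ^ 2 : ℝ) : ℂ) by push_cast; ring,
    Complex.norm_real, Real.norm_of_nonneg h1.le, div_le_iff₀ h1]
  calc ‖(q : ℂ) * f (t + 2 * a) + (1 + (q : ℂ) ^ 2) * f t + (q : ℂ) * f (t - 2 * a)‖
      ≤ ‖(q : ℂ) * f (t + 2 * a)‖ + ‖(1 + (q : ℂ) ^ 2) * f t‖ + ‖(q : ℂ) * f (t - 2 * a)‖ :=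
        norm_add₃_le
    _ = q * ‖f (t + 2 * a)‖ + (1 + q ^ 2) * ‖f t‖ + q * ‖f (t - 2 * a)‖ := by
        rw [norm_mul, norm_mul, norm_mul, show (1 + (q : ℂ) ^ 2) = ((1 + q ^ 2 : ℝ) : ℂ) by
          push_cast; ring, Complex.norm_real, Complex.norm_real, Real.norm_of_nonneg hq,
          Real.norm_of_nonneg (by positivity)]
    _ ≤ q * B + (1 + q ^ 2) * B + q * B := by gcongr <;> exact hB _
    _ = B * (1 + q) ^ 2 := by ring

/-- Support grows by at most `2a`: if `f = 0` off `[-R, R]` then `threePoint a q f = 0` off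
`[-(R + 2a), R + 2a]` (`a ≥ 0`). [folklore] -/
theorem threePoint_eq_zero (ha : 0 ≤ a) {R : ℝ} (hR : ∀ t, R < |t| → f t = 0) (q t : ℝ)
    (ht : R + 2 * a < |t|) : threePoint a q f t = 0 := by
  have h0 : f t = 0 := hR t (by linarith)
  rcases lt_abs.mp ht with h | h
  · have h1 : f (t + 2 * a) = 0 := hR _ (lt_of_lt_of_le (by linarith) (le_abs_self _))
    have h2 : f (t - 2 * a) = 0 := hR _ (lt_of_lt_of_le (by linarith) (le_abs_self _))
    simp [threePoint, h0, h1, h2]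
  · have h1 : f (t + 2 * a) = 0 := hR _ (lt_of_lt_of_le (by linarith) (neg_le_abs _))
    have h2 : f (t - 2 * a) = 0 := hR _ (lt_of_lt_of_le (by linarith) (neg_le_abs _))
    simp [threePoint, h0, h1, h2]

/-- Smoothness is preserved. [folklore] -/
theorem threePoint_contDiff (hf : ContDiff ℝ ∞ f) (a q : ℝ) :
    ContDiff ℝ ∞ (threePoint a q f) := by
  have h1 : ContDiff ℝ ∞ fun t : ℝ ↦ f (t + 2 * a) := hf.comp (contDiff_id.add contDiff_const)
  have h2 : ContDiff ℝ ∞ fun t : ℝ ↦ f (t - 2 * a) := hf.comp (contDiff_id.sub contDiff_const)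
  unfold threePoint
  exact (((contDiff_const.mul h1).add (contDiff_const.mul hf)).add (contDiff_const.mul h2)).div_const _

/-! ## 4. The seed and the iterated tests -/

/-- The seed bump (radii `1/2 < 1`). -/
def cosSeedBump : ContDiffBump (0 : ℝ) := ⟨1 / 2, 1, by norm_num, by norm_num⟩

/-- The seed test `cosSeed t = cosSeedBump t ∈ [0, 1]`: even, real, smooth, `= 0` off `[-1, 1]`,
`∫ cosSeed > 0`. [folklore] -/
def cosSeed : ℝ → ℂ := fun t ↦ ((cosSeedBump t : ℝ) : ℂ)

/-- The seed is smooth. -/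
theorem cosSeed_contDiff : ContDiff ℝ ∞ cosSeed := Complex.ofRealCLM.contDiff.comp cosSeedBump.contDiff

/-- The seed is even. -/
theorem cosSeed_even (t : ℝ) : cosSeed (-t) = cosSeed t := by
  simp only [cosSeed, cosSeedBump.neg]

/-- The seed is real-valued. -/
theorem cosSeed_im (t : ℝ) : (cosSeed t).im = 0 := Complex.ofReal_im _

/-- `‖cosSeed‖ ≤ 1`. -/
theorem norm_cosSeed_le (t : ℝ) : ‖cosSeed t‖ ≤ 1 := by
  rw [cosSeed, Complex.norm_real, Real.norm_of_nonneg cosSeedBump.nonneg]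
  exact cosSeedBump.le_one

/-- `cosSeed = 0` off `[-1, 1]`. -/
theorem cosSeed_eq_zero (t : ℝ) (ht : 1 < |t|) : cosSeed t = 0 := by
  have h : cosSeedBump t = 0 :=
    cosSeedBump.zero_of_le_dist (by simp only [cosSeedBump, Real.dist_eq, sub_zero]; exact ht.le)
  simp [cosSeed, h]

/-- `cosSeed^(1/2) = ∫ cosSeedBump`. [folklore] -/
theorem weilMellin_cosSeed_half : weilMellin cosSeed (1 / 2) = ((∫ t, cosSeedBump t : ℝ) : ℂ) := by
  unfold weilMellin cosSeed
  simp only [sub_self, zero_mul, Complex.exp_zero, mul_one]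
  exact integral_ofReal

/-- `cosSeed^(1/2) ≠ 0` (`ContDiffBump.integral_pos`). [folklore] -/
theorem weilMellin_cosSeed_half_ne_zero : weilMellin cosSeed (1 / 2) ≠ 0 := by
  rw [weilMellin_cosSeed_half, Complex.ofReal_ne_zero]
  exact cosSeedBump.integral_pos.ne'

variable (ρ : ℕ → ℂ)

/-- The iterated tests `φ_0 = cosSeed`, `φ_{K+1} = threePoint a(ρ_K) q(ρ_K) φ_K`. -/
def phiSeq : ℕ → ℝ → ℂ
  | 0 => cosSeed
  | K + 1 => threePoint (halfPeriod (ρ K)) (cosWeight (ρ K)) (phiSeq K)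

/-- Support radius of `φ_K`: `1 + ∑_{k<K} 2a(ρ_k)`. -/
def suppRadius (K : ℕ) : ℝ := 1 + ∑ k ∈ Finset.range K, 2 * halfPeriod (ρ k)

/-- The accumulated multiplier `∏_{k<K} threePointMul a(ρ_k) q(ρ_k) s`. -/
def mulProd (K : ℕ) (s : ℂ) : ℂ :=
  ∏ k ∈ Finset.range K, threePointMul (halfPeriod (ρ k)) (cosWeight (ρ k)) s

/-- The accumulated multiplier on the critical line (a real number in `[0, 1]`). -/
def lineProd (K : ℕ) (y : ℝ) : ℝ :=
  ∏ k ∈ Finset.range K, threePointLine (halfPeriod (ρ k)) (cosWeight (ρ k)) y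

/-- `φ_0 = cosSeed`. -/
@[simp] theorem phiSeq_zero : phiSeq ρ 0 = cosSeed := rfl

/-- The recursion step. -/
theorem phiSeq_succ (K : ℕ) :
    phiSeq ρ (K + 1) = threePoint (halfPeriod (ρ K)) (cosWeight (ρ K)) (phiSeq ρ K) := rfl

/-- Each `φ_K` is smooth. -/
theorem phiSeq_contDiff (K : ℕ) : ContDiff ℝ ∞ (phiSeq ρ K) := by
  induction K with
  | zero => exact cosSeed_contDiff
  | succ K ih => rw [phiSeq_succ]; exact threePoint_contDiff ih _ _

/-- Each `φ_K` is even. -/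
theorem phiSeq_even (K : ℕ) (t : ℝ) : phiSeq ρ K (-t) = phiSeq ρ K t := by
  induction K generalizing t with
  | zero => exact cosSeed_even t
  | succ K ih => rw [phiSeq_succ]; exact threePoint_even ih _ _ t

/-- Each `φ_K` is real-valued. -/
theorem phiSeq_im (K : ℕ) (t : ℝ) : (phiSeq ρ K t).im = 0 := by
  induction K generalizing t with
  | zero => exact cosSeed_im t
  | succ K ih => rw [phiSeq_succ]; exact threePoint_im ih _ _ t

/-- `‖φ_K‖ ≤ 1` uniformly in `K` (probability averages of the seed). [folklore] -/
theorem norm_phiSeq_le (K : ℕ) (t : ℝ) : ‖phiSeq ρ K t‖ ≤ 1 := by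
  induction K generalizing t with
  | zero => exact norm_cosSeed_le t
  | succ K ih => rw [phiSeq_succ]; exact norm_threePoint_le (cosWeight_pos _).le ih _ t

variable {ρ}

/-- `φ_K = 0` off `[-suppRadius K, suppRadius K]`. [folklore] -/
theorem phiSeq_eq_zero (him : ∀ k, 0 < (ρ k).im) (K : ℕ) (t : ℝ) (ht : suppRadius ρ K < |t|) :
    phiSeq ρ K t = 0 := by
  induction K generalizing t with
  | zero => exact cosSeed_eq_zero t (by simpa [suppRadius] using ht)
  | succ K ih =>
    rw [phiSeq_succ]
    refine threePoint_eq_zero (halfPeriod_pos (him K)).le ih _ t ?_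
    simpa [suppRadius, Finset.sum_range_succ, add_assoc] using ht

/-- Each `φ_K` has compact support (in `[-suppRadius K, suppRadius K]`). [folklore] -/
theorem phiSeq_hasCompactSupport (him : ∀ k, 0 < (ρ k).im) (K : ℕ) :
    HasCompactSupport (phiSeq ρ K) := by
  refine HasCompactSupport.intro (K := Icc (-suppRadius ρ K) (suppRadius ρ K)) isCompact_Icc
    fun t ht ↦ phiSeq_eq_zero him K t ?_
  rw [mem_Icc, not_and_or, not_le, not_le] at ht
  exact ht.elim (fun h ↦ lt_abs.mpr (Or.inr (by linarith))) fun h ↦ lt_abs.mpr (Or.inl h)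

/-- Each `φ_K` is an (even, real) Weil test function. [folklore] -/
theorem isWeilTest_phiSeq (him : ∀ k, 0 < (ρ k).im) (K : ℕ) : IsWeilTest (phiSeq ρ K) :=
  ⟨phiSeq_contDiff ρ K, phiSeq_hasCompactSupport him K⟩

/-- **Transform of `φ_K`**: `φ_K^ = (∏_{k<K} threePointMul …) · cosSeed^`. [folklore] -/
theorem weilMellin_phiSeq (him : ∀ k, 0 < (ρ k).im) (K : ℕ) (s : ℂ) :
    weilMellin (phiSeq ρ K) s = mulProd ρ K s * weilMellin cosSeed s := by
  induction K with
  | zero => simp [mulProd]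
  | succ K ih =>
    rw [phiSeq_succ, weilMellin_threePoint (phiSeq_contDiff ρ K).continuous
      (phiSeq_hasCompactSupport him K), ih, mulProd, mulProd, Finset.prod_range_succ]
    ring

/-- `φ_K^(ρ_k) = 0` for `k < K`. [folklore] -/
theorem weilMellin_phiSeq_eq_zero (him : ∀ k, 0 < (ρ k).im) {k K : ℕ} (hk : k < K) :
    weilMellin (phiSeq ρ K) (ρ k) = 0 := by
  rw [weilMellin_phiSeq him, mulProd,
    Finset.prod_eq_zero (Finset.mem_range.mpr hk) (threePointMul_eq_zero (him k)), zero_mul]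

/-- `φ_K^(1/2) = cosSeed^(1/2)` (`≠ 0`). [folklore] -/
theorem weilMellin_phiSeq_half (him : ∀ k, 0 < (ρ k).im) (K : ℕ) :
    weilMellin (phiSeq ρ K) (1 / 2) = weilMellin cosSeed (1 / 2) := by
  rw [weilMellin_phiSeq him, mulProd,
    Finset.prod_eq_one (fun k _ ↦ threePointMul_half (cosWeight_pos (ρ k)).le _), one_mul]

/-- On the critical line: `φ_K^(1/2 + iy) = lineProd K y · cosSeed^(1/2 + iy)`. [folklore] -/
theorem weilMellin_phiSeq_line (him : ∀ k, 0 < (ρ k).im) (K : ℕ) (y : ℝ) :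
    weilMellin (phiSeq ρ K) (1 / 2 + y * I) = (lineProd ρ K y : ℂ) * weilMellin cosSeed (1 / 2 + y * I) := by
  rw [weilMellin_phiSeq him, mulProd, lineProd, Complex.ofReal_prod]
  congr 1
  exact Finset.prod_congr rfl fun k _ ↦ threePointMul_line _ _ _

end Summit.RiemannHypothesis.RiemannHypothesis.Theorems.PfPersistenceM2NegIndex.CosineProduct
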